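import Summits.HodgeConjecture.HodgeConjecture.Theorems.H413ThetaPinBridgeOfMaster
import Summits.HodgeConjecture.HodgeConjecture.Theorems.P2StubU2OfLetters
import Summits.HodgeConjecture.HodgeConjecture.Theorems.F0P2aStubAdmissibleOfCohValued
import Literature.NumberTheory.Automorphic.UnitaryGroupCotangentSpectralProjectionConj
import HarnessLib

/-!
# Crux `H413`, programme P2 — U2′ FROM THE WEAKER ENGINE LETTER (C♭) = «(C) FOR ADMISSIBLE σ» AND (D): admissibility of the finite component is
# DISCHARGED AT THE PIN by ★ S3 (`F0P2aStubAdmissibleOfCohValued.stubS3_holds`), so the (C)-desk line `F0_P2CohFinComponentIsThetaC` needs NO stub CA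

HC_CM is proved only modulo the printed citations until rung 0 closes.

F0P2-p02 (g2), 2026-08-31 (sequel of ★ p796158 `Theorems/H413ThetaPinBridgeOfMaster.lean` and ★ p796532 `Theorems/P2StubU2OfLettersCD.lean`, F0P2-p02 (g0);
shape request to F0P2-plan (g3) on the bus 01:3xZ).  PROOF FILE (theorems only, no `def`, no instance, no notation, no `sorry`) for crux item
`stmt-HodgeConjecture-24833`, `--supports … --as helper`.

WHY.  The coming (C)-desk sub-line cuts the socket (C) `Rogawski1990.cohFinComponent_isTheta` per place (stubs CE∕CL∕CF∕CA∕CI); its stub **CA** («finite components of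
cohomological discrete automorphic representations of `U(H)` are admissible» over the `HasFinComponent` binder) is NOT reachable from ★ S3, which needs `σ` REALISED IN the
cohomological cotangent forms (the intertwiner `σ → P.finRep` may land in a non-cohomological `K_∞`-type; identifying `K_c`-fixed τ-isotypic smooth vectors of `P` with
classes of forms, or bounding `dim P(τ′)^{K_cK_f}`, is Harish-Chandra admissibility ∕ Flath, class U).  But the ONLY consumer of (C) — the U2′ fold ★
`P2StubU2OfLetters.stubU2_of_letters` through the pin bridge — receives `σ` realised in `cohForms 𝔞₀` (`OccursIn`), where S3 applies.  So the honest cheap move is to let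
the engine letter ASSUME admissibility:

* **(C♭)** = the body of ★ `Rogawski1990.cohFinComponent_isTheta` with ONE extra binder `σ.IsAdmissible →` inserted after `σ.IsSmooth →` (spelled out below as the
  hypothesis type of `spectrumIsTheta_of_cohFinComponentAdm_of_master`; (C) ⇒ (C♭) trivially, `cohFinComponentAdm_of_cohFinComponent`);
* `ThetaPinBridge.spectrumIsTheta_of_cohFinComponentAdm_of_master (hC♭)` — ★ p796158's bridge with the admissibility binder threaded (same proof; conclusion = F0P2-p03's
  binder `hB` with the extra binder `σ.IsAdmissible →`);
* `P2StubU2OfLettersCadmD.stubU2_of_letters_adm (hD) (hD̄) (hB♭) : StubU2CohFormsSpectrumIsThetaAt` — ★ p793253's proof + ONE line (`stubS3_holds` at the Sylvester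
  frame on the `OccursIn` witness);
* **`P2StubU2OfLettersCadmD.stub_U2_cohFormsSpectrumIsThetaAt_of_Cadm_D (hC♭) (hD) : StubU2CohFormsSpectrumIsThetaAt`** — the registrar's next parent-line fold
  (socket (C) ↦ (C♭), sockets {C♭, D, U4}).  (Consistency: `…_of_Cadm_D (cohFinComponentAdm_of_cohFinComponent hC) hD` re-derives ★ p796532's
  `stub_U2_cohFormsSpectrumIsThetaAt_of_C_D hC hD` — checked locally, not restated here.)

Sources: [Rogawski1990, Thm. 13.3.6 (c), §14.6, §15.3]; [GelbartRogawski1991, Thm. 5.1.1, Lem. 5.1.2]; [Liu2021, Def. 4.11–4.12, proof of Prop. 4.13 l. 2131–2146, App. D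
§D.1, Lem. D.1]; [BorelJacquet1979, §4.2, §4.5, §4.6]; [BernsteinZelevinsky1976, §2.1]; [BorelWallach2000, VII 3.2, XIII 1.2]; [BushnellHenniart2006, §4.2–4.3].
-/

set_option autoImplicit false

-- the mandated namespace has the single-problem summit's repeated segment (`HodgeConjecture.HodgeConjecture`), as in every `Cruxes/…` module of this sub-problem
set_option linter.dupNamespace false

noncomputable section

namespace Summit.HodgeConjecture.HodgeConjecture.Cruxes.H413.ThetaPinBridge

open scoped ComplexOrder
open Literature.NumberTheory.Automorphic.UnitaryGroup Literature.NumberTheory.Automorphic.UnitaryGroup.CotangentForms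
open scoped TensorProduct Matrix
open NumberField NumberField.InfinitePlace IsDedekindDomain MeasureTheory
open HodgeCM.Model HodgeCM.Model.LiuIndex HodgeCM.Model.TowerCarrier
open Summit.HodgeConjecture.CorCM.Model
open Literature.AlgebraicGeometry.Motives (CMType AbelianVariety)
open Literature.AlgebraicGeometry.HodgeTheory Literature.NumberTheory.Automorphic.PicardCM
open Literature.AlgebraicGeometry.ShimuraVarieties Literature.AlgebraicGeometry.ShimuraVarieties.UnitaryCanonicalModel
open Literature.NumberTheory.ComplexMultiplication
open Literature.NumberTheory.Automorphic
open Literature.NumberTheory.Automorphic.Liu2021 Literature.NumberTheory.Automorphic.Liu2021.AppendixC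
open Literature.NumberTheory.Automorphic.Liu2021.Def411WeilCarriers
open Literature.NumberTheory.Automorphic.Liu2021.Def411WeilCarriersDoubling
open Literature.NumberTheory.Automorphic.IdeleClassGroup
open Literature.NumberTheory.GelbartRogawski1991 Literature.NumberTheory.GelbartRogawski1991.UnitaryDualPair
open Literature.RepresentationTheory Literature.RepresentationTheory.Liu2021
open Literature.NumberTheory.Rogawski1990
open Summit.HodgeConjecture.CorCM
open Summit.HodgeConjecture.CorCM.Transposition
open Summit.HodgeConjecture.CorCM.Transposition.OmegaTransport (realUnit)
open HodgeCM.Model.ArchSideTerm (e₁)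
open Literature.NumberTheory.GelbartRogawski1991.OscillatorTripleDictionary (OccursInH1 IsIsoToOmega rhoTriple)
open MulAction
open Literature.Geometry.ComplexHyperbolic.BallModel (U21 x₀)
open Summit.HodgeConjecture.CorCM.Lines.A3Liu413 (datum413)
open Summit.HodgeConjecture.HodgeConjecture.Cruxes.H413.CohFormsCarriers
open Summit.HodgeConjecture.HodgeConjecture.Cruxes.H413.SpectrumInterfaces

/-! ## §1  The pin bridge from (C♭) (= (C) for admissible `σ`) by the ★ master -/

set_option synthInstance.maxHeartbeats 400000 in
set_option maxHeartbeats 8000000 in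
/-- **THE THETA PIN BRIDGE FROM THE WEAKER ENGINE LETTER (C♭) (= ★ `Rogawski1990.cohFinComponent_isTheta` with the extra binder `σ.IsAdmissible →` after
`σ.IsSmooth →`, spelled out as the hypothesis)**: for every face, every automorphic `μ`, every irreducible smooth ADMISSIBLE `σ` of `U(V)(𝔸_{F⁺,f})` and every discrete
automorphic `Π` that is `H¹`-cohomological of type `(1,0)` or `(0,1)` at the factor of record with finite component `σ`, there are a compact open `K` and a triple `t` of the
PRINTED datum with `μ_t` of weight one, `ε_t` global, and `σ`, `ω_t` Hecke-related at level `K` — the proof of ★ `spectrumIsTheta_of_cohFinComponent_of_master` (p796158)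
verbatim with the admissibility hypothesis threaded into the letter.  [cite: Liu2021, Def. 4.11–4.12; proof of Prop. 4.13 l. 2140–2146; App. D §D.1 Step 1 footnote, Lem. D.1]
[cite: Rogawski1990, Thm. 13.3.6; §15.3] [cite: GelbartRogawski1991, Thm 5.1.1 p. 465; Lemma 5.1.2 p. 466] [cite: BorelJacquet1979, §4.5–4.6] -/
theorem spectrumIsTheta_of_cohFinComponentAdm_of_master
    (hC :
      ∀ (L : Type) [Field L] [NumberField L] [IsCMField L] (ι : L →+* ℂ) (H : Matrix (Fin 3) (Fin 3) L) (T : GL (Fin 3) ℂ)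
        (hT : (T : Matrix (Fin 3) (Fin 3) ℂ)ᴴ * H.map ι * (T : Matrix (Fin 3) (Fin 3) ℂ) = Literature.Geometry.ComplexHyperbolic.BallModel.J),
        (∀ τ' : L →+* ℂ, InfinitePlace.mk τ' ≠ InfinitePlace.mk ι → (H.map τ').PosDef) →
        2 ≤ Module.finrank ℚ ↥(maximalRealSubfield L) →
        -- the ω-side frame data (lane convention: diagonal Gram matrix over `L⁺`) and the frame transport, pinned extensionally
        ∀ {n' : ℕ} (e₁ : Fin 3 × Fin 1 ≃ Fin n') (dV : Fin 3 → L) (hdV : ∀ i, IsCMField.complexConj L (dV i) = dV i)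
          (hdV0 : ∀ i, dV i ≠ 0) (g : GL (Fin 3) L),
          ((g : Matrix (Fin 3) (Fin 3) L).map (cmConjRingHom L))ᵀ * H * (g : Matrix (Fin 3) (Fin 3) L) = Matrix.diagonal dV →
        ∀ (ιV : finAdelic (↥(maximalRealSubfield L)) L (IsCMField.complexConj L) 3 H →*
            finAdelic (↥(maximalRealSubfield L)) L (IsCMField.complexConj L) 3 (Matrix.diagonal dV)),
          (∀ k : finAdelic (↥(maximalRealSubfield L)) L (IsCMField.complexConj L) 3 H,
            ((ιV k : finAdelic (↥(maximalRealSubfield L)) L (IsCMField.complexConj L) 3 (Matrix.diagonal dV)) :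
                GL (Fin 3) (FiniteAdeleRing (𝓞 L) L)) =
              (toFinAdeleGL L 3 g)⁻¹ * (k : GL (Fin 3) (FiniteAdeleRing (𝓞 L) L)) * toFinAdeleGL L 3 g) →
        ∀ (μ : Measure (adelicGroupData (↥(maximalRealSubfield L)) L (IsCMField.complexConj L) 3 H).automorphicQuotient)
          [(adelicGroupData (↥(maximalRealSubfield L)) L (IsCMField.complexConj L) 3 H).IsAutomorphicMeasure μ]
          (W : Type) [AddCommGroup W] [Module ℂ W]
          (σ : Representation ℂ (finAdelic (↥(maximalRealSubfield L)) L (IsCMField.complexConj L) 3 H) W),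
          σ.IsIrreducible → σ.IsSmooth → σ.IsAdmissible →
        ∀ P : DiscreteAutomorphicRep (adelicGroupData (↥(maximalRealSubfield L)) L (IsCMField.complexConj L) 3 H) μ,
          (P.IsHolCotangentAt (cmArchSection L ι H T hT) (cmCompactFactor L ι H T hT) ∨
              P.IsAntiholCotangentAt (cmArchSection L ι H T hT) (cmCompactFactor L ι H T hT)) →
          P.HasFinComponent σ →
            ∃ (μ : Literature.NumberTheory.Automorphic.IdeleClassGroup L →ₜ* Circle)
              (hμ : Literature.NumberTheory.Automorphic.IdeleClassGroup.IsConjugateSymplectic L μ),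
              Literature.NumberTheory.Automorphic.IdeleClassGroup.HasWeight L μ 1 ∧
              ∃ (a : (↥(maximalRealSubfield L))ˣ) (χ : Chi (↥(maximalRealSubfield L)) L (IsCMField.complexConj L)),
                ∃ f : σ.IntertwiningMap
                    (rhoAtLine (↥(maximalRealSubfield L)) L (IsCMField.complexConj L) 3 e₁ (Matrix.diagonal dV)
                      (complexConj_imagUnit L) (imagUnit_ne_zero L) (imagUnit_mul_self L) (realDiagonal_isSymm L dV hdV)
                      (isUnit_det_realDiagonal L dV hdV hdV0) (realDiagonal_map L dV hdV).symm
                      (fun a => isCompatible_chiSplittingLine L e₁ dV hdV hdV0 (toHeckeCharacter L μ)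
                        (isUnitary_toHeckeCharacter L μ) ((isOscillatorChar_toHeckeCharacter_iff μ).mpr hμ)
                        (TW (↥(maximalRealSubfield L)) a) (isSymm_TW (↥(maximalRealSubfield L)) a)
                        (isUnit_det_TW (↥(maximalRealSubfield L)) a) (JW (↥(maximalRealSubfield L)) L a)
                        (JW_eq (↥(maximalRealSubfield L)) L a))
                      ιV a χ),
                  Function.Injective f) :
    ∀ (hDel : canonicalModel_exists_printed) (F : HodgeCM.CMField) [IsGalois ℚ F] (h6 : 6 ≤ Module.finrank ℚ F) {ι₁ : F →+* ℂ}
      (V : HodgeCM.HermSpace3 F ι₁) (a₀ : RealScalar F) (Φ : CMType F) (hΦ : ι₁ ∈ Φ.1) (i : I V (repAt a₀) (muLiu ι₁ GramClass.rep))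
      (μ : Measure (adelicDatum F V).automorphicQuotient) [(adelicDatum F V).IsAutomorphicMeasure μ]
      (W : Type) [AddCommGroup W] [Module ℂ W] (σ : Representation ℂ ↥(HodgeCM.HermSpace3.adelicFin V) W),
      σ.IsIrreducible → σ.IsSmooth → σ.IsAdmissible →
        ∀ P : DiscreteAutomorphicRep (adelicDatum F V) μ,
          (P.IsHolCotangentAt (archFactorOf F V).ιinf (archFactorOf F V).Kc ∨
              P.IsAntiholCotangentAt (archFactorOf F V).ιinf (archFactorOf F V).Kc) →
            P.HasFinComponent σ →
              ∃ K : Subgroup ↥(HodgeCM.HermSpace3.adelicFin V),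
                IsOpen (K : Set ↥(HodgeCM.HermSpace3.adelicFin V)) ∧ IsCompact (K : Set ↥(HodgeCM.HermSpace3.adelicFin V)) ∧
                  ∃ t : (datum413 hDel F V a₀ Φ i).Triple, t.HasWeightOne ∧ IsGlobalEps (datum413 hDel F V a₀ Φ i) t.ε ∧
                    HeckeRelatedAt K σ (rhoTriple (datum413 hDel F V a₀ Φ i) t) := by
  intro hDel F _ h6 ι₁ V a₀ Φ hΦ i μ _ W _ _ σ hirr hsm hadm P hP hfin
  -- (1) the engine letter (C♭) at the pin (admissibility threaded)
  have h2 : 2 ≤ Module.finrank ℚ ↥(maximalRealSubfield (HodgeCM.CMField.K F)) :=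
    two_le_finrank_maximalRealSubfield (HodgeCM.CMField.K F) h6
  haveI : (UnitaryGroup.adelicGroupData (↥(maximalRealSubfield (HodgeCM.CMField.K F))) (HodgeCM.CMField.K F)
      (IsCMField.complexConj (HodgeCM.CMField.K F)) 3 (HodgeCM.HermSpace3.Hm V)).IsAutomorphicMeasure μ := ‹_›
  obtain ⟨μc, hμc, hw, a, χ, f, hf⟩ :=
    hC (HodgeCM.CMField.K F) ι₁ (HodgeCM.HermSpace3.Hm V) V.sylvesterFrame (HodgeCM.Model.sylvesterFrame_J V) V.posDef_of_ne h2
      e₁ (frameD V) (frameD_real V) (frameD_ne V) (frameG V) (frame_congr V) (ιVE V)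
      (fun k => coe_finFrameCongr (HodgeCM.CMField.K F) V.Hm (frameG V) (frameD V) (frame_congr V) k)
      μ W σ hirr hsm hadm P hP hfin
  -- (2) the triple of the printed datum and the globality of its `ε`
  let t : (datum413 hDel F V a₀ Φ i).Triple :=
    ⟨μc, hμc, locF (↥(maximalRealSubfield (HodgeCM.CMField.K F))) (imagUnitSq (HodgeCM.CMField.K F)) a, χ⟩
  have hglob : IsGlobalEps (datum413 hDel F V a₀ Φ i) t.ε := isGlobal_line (HodgeCM.CMField.K F) a
  -- (3) move the line to the datum's representative by the ★ MASTER (rank 3, frame `e₁ = Equiv.prodUnique (Fin 3) (Fin 1)`)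
  obtain ⟨e', he'⟩ := exists_intertwiner_repLine_of_master (HodgeCM.CMField.K F) (by norm_num : 0 < 3) (frameD V) (frameD_real V)
    (frameD_ne V) (toHeckeCharacter (HodgeCM.CMField.K F) μc) (isUnitary_toHeckeCharacter (HodgeCM.CMField.K F) μc)
    ((isOscillatorChar_toHeckeCharacter_iff μc).mpr hμc) (ιVE V) χ
    (Rep.update (↥(maximalRealSubfield (HodgeCM.CMField.K F))) (imagUnitSq (HodgeCM.CMField.K F))
      (Rep.ofLineOf (↥(maximalRealSubfield (HodgeCM.CMField.K F))) (imagUnitSq (HodgeCM.CMField.K F)))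
      (locF (↥(maximalRealSubfield (HodgeCM.CMField.K F))) (imagUnitSq (HodgeCM.CMField.K F))
        (realUnit ⟨HodgeCM.CMField.K F⟩ (repAt a₀ (Sigma.fst i)).1 (repAt a₀ (Sigma.fst i)).2.1 (repAt a₀ (Sigma.fst i)).2.2))
      (realUnit ⟨HodgeCM.CMField.K F⟩ (repAt a₀ (Sigma.fst i)).1 (repAt a₀ (Sigma.fst i)).2.1 (repAt a₀ (Sigma.fst i)).2.2) rfl)
    a
  obtain ⟨g, hg⟩ : ∃ g : σ.IntertwiningMap (rhoTriple (datum413 hDel F V a₀ Φ i) t), Function.Injective g :=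
    exists_injective_comp f hf e' he'
  -- (4) Hecke-relatedness at a compact open level
  obtain ⟨K, hKo, hKc, hrel⟩ :=
    Literature.NumberTheory.Automorphic.exists_heckeRelated_of_intertwiningMap σ (rhoTriple (datum413 hDel F V a₀ Φ i) t)
      (UnitaryGroup.finAdelicIntegralLevel (↥(maximalRealSubfield (HodgeCM.CMField.K F))) (HodgeCM.CMField.K F)
        (IsCMField.complexConj (HodgeCM.CMField.K F)) 3 (HodgeCM.HermSpace3.Hm V))
      (UnitaryGroup.isCompact_finAdelicIntegralLevel _ _ _ _ _) (UnitaryGroup.isOpen_finAdelicIntegralLevel _ _ _ _ _)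
      hirr hsm g hg
  exact ⟨K, hKo, hKc, t, hw, hglob, hrel⟩

/-- (C) ⇒ (C♭): the printed letter implies its admissibility-hungry weakening (drop the extra hypothesis). [cite: Rogawski1990, Thm. 13.3.6 (c); §15.3] -/
theorem cohFinComponentAdm_of_cohFinComponent (hC : cohFinComponent_isTheta) :
      ∀ (L : Type) [Field L] [NumberField L] [IsCMField L] (ι : L →+* ℂ) (H : Matrix (Fin 3) (Fin 3) L) (T : GL (Fin 3) ℂ)
        (hT : (T : Matrix (Fin 3) (Fin 3) ℂ)ᴴ * H.map ι * (T : Matrix (Fin 3) (Fin 3) ℂ) = Literature.Geometry.ComplexHyperbolic.BallModel.J),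
        (∀ τ' : L →+* ℂ, InfinitePlace.mk τ' ≠ InfinitePlace.mk ι → (H.map τ').PosDef) →
        2 ≤ Module.finrank ℚ ↥(maximalRealSubfield L) →
        -- the ω-side frame data (lane convention: diagonal Gram matrix over `L⁺`) and the frame transport, pinned extensionally
        ∀ {n' : ℕ} (e₁ : Fin 3 × Fin 1 ≃ Fin n') (dV : Fin 3 → L) (hdV : ∀ i, IsCMField.complexConj L (dV i) = dV i)
          (hdV0 : ∀ i, dV i ≠ 0) (g : GL (Fin 3) L),
          ((g : Matrix (Fin 3) (Fin 3) L).map (cmConjRingHom L))ᵀ * H * (g : Matrix (Fin 3) (Fin 3) L) = Matrix.diagonal dV →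
        ∀ (ιV : finAdelic (↥(maximalRealSubfield L)) L (IsCMField.complexConj L) 3 H →*
            finAdelic (↥(maximalRealSubfield L)) L (IsCMField.complexConj L) 3 (Matrix.diagonal dV)),
          (∀ k : finAdelic (↥(maximalRealSubfield L)) L (IsCMField.complexConj L) 3 H,
            ((ιV k : finAdelic (↥(maximalRealSubfield L)) L (IsCMField.complexConj L) 3 (Matrix.diagonal dV)) :
                GL (Fin 3) (FiniteAdeleRing (𝓞 L) L)) =
              (toFinAdeleGL L 3 g)⁻¹ * (k : GL (Fin 3) (FiniteAdeleRing (𝓞 L) L)) * toFinAdeleGL L 3 g) →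
        ∀ (μ : Measure (adelicGroupData (↥(maximalRealSubfield L)) L (IsCMField.complexConj L) 3 H).automorphicQuotient)
          [(adelicGroupData (↥(maximalRealSubfield L)) L (IsCMField.complexConj L) 3 H).IsAutomorphicMeasure μ]
          (W : Type) [AddCommGroup W] [Module ℂ W]
          (σ : Representation ℂ (finAdelic (↥(maximalRealSubfield L)) L (IsCMField.complexConj L) 3 H) W),
          σ.IsIrreducible → σ.IsSmooth → σ.IsAdmissible →
        ∀ P : DiscreteAutomorphicRep (adelicGroupData (↥(maximalRealSubfield L)) L (IsCMField.complexConj L) 3 H) μ,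
          (P.IsHolCotangentAt (cmArchSection L ι H T hT) (cmCompactFactor L ι H T hT) ∨
              P.IsAntiholCotangentAt (cmArchSection L ι H T hT) (cmCompactFactor L ι H T hT)) →
          P.HasFinComponent σ →
            ∃ (μ : Literature.NumberTheory.Automorphic.IdeleClassGroup L →ₜ* Circle)
              (hμ : Literature.NumberTheory.Automorphic.IdeleClassGroup.IsConjugateSymplectic L μ),
              Literature.NumberTheory.Automorphic.IdeleClassGroup.HasWeight L μ 1 ∧
              ∃ (a : (↥(maximalRealSubfield L))ˣ) (χ : Chi (↥(maximalRealSubfield L)) L (IsCMField.complexConj L)),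
                ∃ f : σ.IntertwiningMap
                    (rhoAtLine (↥(maximalRealSubfield L)) L (IsCMField.complexConj L) 3 e₁ (Matrix.diagonal dV)
                      (complexConj_imagUnit L) (imagUnit_ne_zero L) (imagUnit_mul_self L) (realDiagonal_isSymm L dV hdV)
                      (isUnit_det_realDiagonal L dV hdV hdV0) (realDiagonal_map L dV hdV).symm
                      (fun a => isCompatible_chiSplittingLine L e₁ dV hdV hdV0 (toHeckeCharacter L μ)
                        (isUnitary_toHeckeCharacter L μ) ((isOscillatorChar_toHeckeCharacter_iff μ).mpr hμ)
                        (TW (↥(maximalRealSubfield L)) a) (isSymm_TW (↥(maximalRealSubfield L)) a)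
                        (isUnit_det_TW (↥(maximalRealSubfield L)) a) (JW (↥(maximalRealSubfield L)) L a)
                        (JW_eq (↥(maximalRealSubfield L)) L a))
                      ιV a χ),
                  Function.Injective f := by
  intro L _ _ _ ι H T hT hdef hrk n' e₁ dV hdV hdV0 g hg ιV hιV μ hμ W _ _ σ hirr hsm _ P hP hfin
  exact hC L ι H T hT hdef hrk e₁ dV hdV hdV0 g hg ιV hιV μ W σ hirr hsm P hP hfin

end Summit.HodgeConjecture.HodgeConjecture.Cruxes.H413.ThetaPinBridge

namespace Summit.HodgeConjecture.HodgeConjecture.Cruxes.H413.P2StubU2OfLettersCadmD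

open scoped ComplexOrder
open Literature.NumberTheory.Automorphic.IdeleClassGroup
open Literature.NumberTheory.Automorphic.Liu2021.Def411WeilCarriers Literature.NumberTheory.Automorphic.Liu2021.Def411WeilCarriersDoubling
open scoped TensorProduct Matrix InnerProductSpace ENNReal ComplexOrder
open MeasureTheory
open NumberField NumberField.InfinitePlace IsDedekindDomain
open HodgeCM.Model HodgeCM.Model.LiuIndex HodgeCM.Model.TowerCarrier
open Summit.HodgeConjecture.CorCM.Model
open Literature.AlgebraicGeometry.Motives (CMType AbelianVariety)
open Literature.AlgebraicGeometry.ShimuraVarieties Literature.AlgebraicGeometry.ShimuraVarieties.UnitaryCanonicalModel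
open Literature.NumberTheory.Automorphic
open Literature.NumberTheory.Automorphic.Liu2021 Literature.NumberTheory.Automorphic.Liu2021.AppendixC
open Literature.NumberTheory.GelbartRogawski1991 Literature.NumberTheory.GelbartRogawski1991.UnitaryDualPair
open Literature.RepresentationTheory Literature.RepresentationTheory.Liu2021
open Summit.HodgeConjecture.CorCM
open Literature.NumberTheory.GelbartRogawski1991.OscillatorTripleDictionary (rhoTriple)
open Literature.Geometry.ComplexHyperbolic.BallModel (U21 x₀)
open Summit.HodgeConjecture.CorCM.Lines.A3Liu413 (datum413)
open Summit.HodgeConjecture.HodgeConjecture.Cruxes.H413.CohFormsCarriers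
open Literature.NumberTheory.Automorphic.UnitaryGroup
open Literature.NumberTheory.Automorphic.UnitaryGroup.CotangentForms (toQuotFun cmArchSection cmCompactFactor cohForms_le_smoothFun
  isSmooth_of_equivariant_of_le_smoothFun holCotFormSpectralProjection antiholCotFormSpectralProjection)
open Summit.HodgeConjecture.HodgeConjecture.Cruxes.H413.F0P3SpectralJunction
open Summit.HodgeConjecture.HodgeConjecture.Cruxes.H413.F0P3StubS5Fold (two_le_finrank_maximalRealSubfield exists_ne_zero_containsForm_of_classes)
open Summit.HodgeConjecture.HodgeConjecture.Cruxes.H413.F0P3HilbertProjection (orthogonalProjectionOnto_ne_zero)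
open Summit.HodgeConjecture.HodgeConjecture.Cruxes.H413.CohFormsL2 (continuous_apply_of_mem_cohForms)
open Summit.HodgeConjecture.HodgeConjecture.Cruxes.H413.SpectrumJunction (continuous_toQuotFun cohForms_eq_generic compactSpace_automorphicQuotient_adelicDatum)
open Summit.HodgeConjecture.HodgeConjecture.Cruxes.H413.SpectrumInterfaces

/-! ## §2  U2′ from (D), (D̄) and an admissibility-hungry bridge; the fold from (C♭) and (D) -/

set_option synthInstance.maxHeartbeats 400000 in
set_option maxHeartbeats 8000000 in
/-- **THE U2′ FOLD WITH AN ADMISSIBILITY-HUNGRY BRIDGE — `StubU2CohFormsSpectrumIsThetaAt` (BY NAME)** from the spectral-projection letters (D)∕(D̄) and a theta pin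
bridge `hB` that may ASSUME `σ.IsAdmissible` (the extra binder after `σ.IsSmooth`): the proof is ★ `P2StubU2OfLetters.stubU2_of_letters` (F0P2-p03 (g0)) verbatim
plus ONE line — at the pin `σ` arrives REALISED in `cohForms 𝔞₀` (`OccursIn`: a non-zero equivariant `θ : σ → cohForms (archFactorOf F V)`), so `σ` is admissible by
★ `F0P2aStubAdmissibleOfCohValued.stubS3_holds` at the Sylvester frame (`(archFactorOf F V).ιinf ∕ .Kc` ARE `cmArchSection ∕ cmCompactFactor` of that frame, `rfl`;
`cohForms_eq_generic`).  Steps 2–5 unchanged (automorphic measure on the compact quotient, J1′, the Hodge split + (D)∕(D̄) detection, the bridge).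
[cite: BorelJacquet1979, §4.2, §4.6] [cite: BernsteinZelevinsky1976, §2.1] [cite: BorelWallach2000, VII 3.2; XIII 1.2] [cite: Rogawski1990, Thm. 13.3.6 (c); §15.3]
[cite: Liu2021, proof of Prop. 4.13 l. 2131–2146; Rem. 4.14; App. D Lem. D.1] -/
theorem stubU2_of_letters_adm (hD : holCotFormSpectralProjection) (hD' : antiholCotFormSpectralProjection)
    (hB : ∀ (hDel : Literature.AlgebraicGeometry.ShimuraVarieties.UnitaryCanonicalModel.canonicalModel_exists_printed)
      (F : HodgeCM.CMField) [IsGalois ℚ F] (h6 : 6 ≤ Module.finrank ℚ F) {ι₁ : F →+* ℂ} (V : HodgeCM.HermSpace3 F ι₁) (a₀ : RealScalar F)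
      (Φ : CMType F) (hΦ : ι₁ ∈ Φ.1) (i : (I V (repAt a₀) (muLiu ι₁ GramClass.rep)))
      (μ : Measure (adelicDatum F V).automorphicQuotient) [(adelicDatum F V).IsAutomorphicMeasure μ]
      (W : Type) [AddCommGroup W] [Module ℂ W] (σ : Representation ℂ ↥(HodgeCM.HermSpace3.adelicFin V) W),
      σ.IsIrreducible → σ.IsSmooth → σ.IsAdmissible →
      ∀ P : DiscreteAutomorphicRep (adelicDatum F V) μ,
        (P.IsHolCotangentAt (archFactorOf F V).ιinf (archFactorOf F V).Kc ∨ P.IsAntiholCotangentAt (archFactorOf F V).ιinf (archFactorOf F V).Kc) →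
        P.HasFinComponent σ →
        ∃ K : Subgroup ↥(HodgeCM.HermSpace3.adelicFin V), IsOpen (K : Set ↥(HodgeCM.HermSpace3.adelicFin V)) ∧
          IsCompact (K : Set ↥(HodgeCM.HermSpace3.adelicFin V)) ∧
          ∃ t : (datum413 hDel F V a₀ Φ i).Triple, t.HasWeightOne ∧ IsGlobalEps (datum413 hDel F V a₀ Φ i) t.ε ∧
            HeckeRelatedAt K σ (rhoTriple (datum413 hDel F V a₀ Φ i) t)) :
    StubU2CohFormsSpectrumIsThetaAt := by
  intro hDel F _ h6 ι₁ V a₀ Φ hΦ i _hn W _ _ σ hirr hocc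
  obtain ⟨θ, hθ0, hθA, hθσ⟩ := hocc
  have h4 : 4 ≤ Module.finrank ℚ F := le_trans (by norm_num) h6
  -- `[F⁺:ℚ] ≥ 2` (`[F:ℚ] = 2 [F⁺:ℚ] ≥ 6`): the «genuine inner form» binder of the letters
  have h2 := two_le_finrank_maximalRealSubfield F h6
  -- step 2: an automorphic measure on the compact quotient
  obtain ⟨μ, hμ⟩ := exists_isAutomorphicMeasure (V := V) h4
  haveI := hμ
  haveI := compactSpace_automorphicQuotient_adelicDatum F V h4
  -- step 1: `σ` is smooth
  have hsm : σ.IsSmooth :=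
    isSmooth_of_equivariant_of_le_smoothFun σ hirr _ cohForms_le_smoothFun θ hθ0 (fun w => (cohForms_eq_generic (archFactorOf F V)) ▸ hθA w) hθσ
  -- step 1♭: `σ` is ADMISSIBLE — ★ S3 of the B4-archimedean desk (`F0P2aStubAdmissibleOfCohValued.stubS3_holds`, F0P2a-p07): an irreducible smooth `σ`
  -- with a non-zero equivariant map into the cohomological cotangent forms of the CM factor of ANY frame is admissible (here: the Sylvester frame of the pin)
  have hadm : σ.IsAdmissible :=
    Summit.HodgeConjecture.HodgeConjecture.Cruxes.H413.F0P2aStubAdmissibleOfCohValued.stubS3_holds (HodgeCM.CMField.K F) ι₁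
      (HodgeCM.HermSpace3.Hm V) V.sylvesterFrame (HodgeCM.Model.sylvesterFrame_J V) V.posDef_of_ne h2 W σ hirr hsm θ hθσ
      (fun w => (cohForms_eq_generic (archFactorOf F V)) ▸ hθA w) hθ0
  -- step 3: J1′
  obtain ⟨P, w, j, h, hu, hfin⟩ := exists_discreteAutomorphicRep_of_equivariant_cohForms h4 μ (archFactorOf F V)
    (continuous_apply_of_mem_cohForms F V h4) σ hirr θ hθσ hθA hθ0
  -- every coordinate of every cotangent form is `L²` (continuity on the compact quotient)
  have hmem : ∀ f ∈ cohForms (archFactorOf F V), ∀ j : Fin 2, MemLp (toQuotFun (adelicDatum F V) fun x => f x j) 2 μ :=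
    fun f hf j => memLp_of_continuous (continuous_toQuotFun (cohForms_left_invariant_apply (archFactorOf F V) hf j) (continuous_apply_of_mem_cohForms F V h4 f hf j))
  -- step 4: split the value `θ w` along `cohForms = holCotForms ⊔ conj holCotForms`
  obtain ⟨A, hA, B, hB', hAB⟩ := Submodule.mem_sup.mp (hθA w)
  have hAc : A ∈ cohForms (archFactorOf F V) := Submodule.mem_sup_left hA
  have hBc : B ∈ cohForms (archFactorOf F V) := Submodule.mem_sup_right hB'
  have hsum : h.toLp (toQuotFun (adelicDatum F V) fun x => θ w x j) =
      (hmem A hAc j).toLp (toQuotFun (adelicDatum F V) fun x => A x j) +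
        (hmem B hBc j).toLp (toQuotFun (adelicDatum F V) fun x => B x j) := by
    rw [← MemLp.toLp_add]
    exact MemLp.toLp_congr _ _ (Filter.EventuallyEq.of_eq (funext fun y => by simp only [toQuotFun, ← hAB, Pi.add_apply]))
  obtain ⟨u, huP, hne⟩ := hu
  have hsplit : ⟪(u : (adelicDatum F V).L2 μ), (hmem A hAc j).toLp (toQuotFun (adelicDatum F V) fun x => A x j)⟫_ℂ ≠ 0 ∨
      ⟪(u : (adelicDatum F V).L2 μ), (hmem B hBc j).toLp (toQuotFun (adelicDatum F V) fun x => B x j)⟫_ℂ ≠ 0 := by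
    by_contra hcon
    push Not at hcon
    apply hne
    rw [hsum, inner_add_right, hcon.1, hcon.2, add_zero]
  -- the letter (D): the projection onto `P` of the (anti)holomorphic summand is a NON-ZERO (anti)holomorphic cotangent form CONTAINED in `P`
  have htype : P.IsHolCotangentAt (archFactorOf F V).ιinf (archFactorOf F V).Kc ∨
      P.IsAntiholCotangentAt (archFactorOf F V).ιinf (archFactorOf F V).Kc := by
    rcases hsplit with hA1 | hB1
    · left
      obtain ⟨Ψ, hΨ, hΨ', heq⟩ := hD (HodgeCM.CMField.K F) ι₁ (HodgeCM.HermSpace3.Hm V) V.sylvesterFrame (HodgeCM.Model.sylvesterFrame_J V)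
        V.posDef_of_ne h2 μ P A hA (hmem A hAc)
      refine exists_ne_zero_containsForm_of_classes P hΨ hΨ' (fun j' => ?_) ⟨j, ?_⟩
      · rw [← heq j']
        exact Submodule.starProjection_apply_mem _ _
      · rw [← heq j, Submodule.starProjection_apply]
        exact Subtype.coe_ne_coe.mpr (orthogonalProjectionOnto_ne_zero P.space ⟨u, huP, hA1⟩)
    · right
      obtain ⟨Ψ, hΨ, hΨ', heq⟩ := hD' (HodgeCM.CMField.K F) ι₁ (HodgeCM.HermSpace3.Hm V) V.sylvesterFrame (HodgeCM.Model.sylvesterFrame_J V)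
        V.posDef_of_ne h2 μ P B hB' (hmem B hBc)
      refine exists_ne_zero_containsForm_of_classes P hΨ hΨ' (fun j' => ?_) ⟨j, ?_⟩
      · rw [← heq j']
        exact Submodule.starProjection_apply_mem _ _
      · rw [← heq j, Submodule.starProjection_apply]
        exact Subtype.coe_ne_coe.mpr (orthogonalProjectionOnto_ne_zero P.space ⟨u, huP, hB1⟩)
  -- step 5: the theta pin bridge
  exact hB hDel F h6 V a₀ Φ hΦ i μ W σ hirr hsm hadm P htype hfin

/-- **U2′ FROM (C♭) AND (D) ALONE — `StubU2CohFormsSpectrumIsThetaAt` BY NAME** (the registrar's fold once the parent line's socket (C) is replaced by (C♭)):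
(D̄) ⇐ (D) by ★ `antiholCotFormSpectralProjection_of_hol` (p794879), the bridge = `ThetaPinBridge.spectrumIsTheta_of_cohFinComponentAdm_of_master`.
[cite: Rogawski1990, Thm. 13.3.6 (c); §14.6; §15.3] [cite: GelbartRogawski1991, Thm 5.1.1 p. 465; Lemma 5.1.2 p. 466] [cite: Liu2021, proof of Prop. 4.13 l. 2131–2146; App. D Lem. D.1]
[cite: BorelJacquet1979, §4.6] -/
theorem stub_U2_cohFormsSpectrumIsThetaAt_of_Cadm_D
    (hC :
      ∀ (L : Type) [Field L] [NumberField L] [IsCMField L] (ι : L →+* ℂ) (H : Matrix (Fin 3) (Fin 3) L) (T : GL (Fin 3) ℂ)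
        (hT : (T : Matrix (Fin 3) (Fin 3) ℂ)ᴴ * H.map ι * (T : Matrix (Fin 3) (Fin 3) ℂ) = Literature.Geometry.ComplexHyperbolic.BallModel.J),
        (∀ τ' : L →+* ℂ, InfinitePlace.mk τ' ≠ InfinitePlace.mk ι → (H.map τ').PosDef) →
        2 ≤ Module.finrank ℚ ↥(maximalRealSubfield L) →
        -- the ω-side frame data (lane convention: diagonal Gram matrix over `L⁺`) and the frame transport, pinned extensionally
        ∀ {n' : ℕ} (e₁ : Fin 3 × Fin 1 ≃ Fin n') (dV : Fin 3 → L) (hdV : ∀ i, IsCMField.complexConj L (dV i) = dV i)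
          (hdV0 : ∀ i, dV i ≠ 0) (g : GL (Fin 3) L),
          ((g : Matrix (Fin 3) (Fin 3) L).map (cmConjRingHom L))ᵀ * H * (g : Matrix (Fin 3) (Fin 3) L) = Matrix.diagonal dV →
        ∀ (ιV : finAdelic (↥(maximalRealSubfield L)) L (IsCMField.complexConj L) 3 H →*
            finAdelic (↥(maximalRealSubfield L)) L (IsCMField.complexConj L) 3 (Matrix.diagonal dV)),
          (∀ k : finAdelic (↥(maximalRealSubfield L)) L (IsCMField.complexConj L) 3 H,
            ((ιV k : finAdelic (↥(maximalRealSubfield L)) L (IsCMField.complexConj L) 3 (Matrix.diagonal dV)) :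
                GL (Fin 3) (FiniteAdeleRing (𝓞 L) L)) =
              (toFinAdeleGL L 3 g)⁻¹ * (k : GL (Fin 3) (FiniteAdeleRing (𝓞 L) L)) * toFinAdeleGL L 3 g) →
        ∀ (μ : Measure (adelicGroupData (↥(maximalRealSubfield L)) L (IsCMField.complexConj L) 3 H).automorphicQuotient)
          [(adelicGroupData (↥(maximalRealSubfield L)) L (IsCMField.complexConj L) 3 H).IsAutomorphicMeasure μ]
          (W : Type) [AddCommGroup W] [Module ℂ W]
          (σ : Representation ℂ (finAdelic (↥(maximalRealSubfield L)) L (IsCMField.complexConj L) 3 H) W),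
          σ.IsIrreducible → σ.IsSmooth → σ.IsAdmissible →
        ∀ P : DiscreteAutomorphicRep (adelicGroupData (↥(maximalRealSubfield L)) L (IsCMField.complexConj L) 3 H) μ,
          (P.IsHolCotangentAt (cmArchSection L ι H T hT) (cmCompactFactor L ι H T hT) ∨
              P.IsAntiholCotangentAt (cmArchSection L ι H T hT) (cmCompactFactor L ι H T hT)) →
          P.HasFinComponent σ →
            ∃ (μ : Literature.NumberTheory.Automorphic.IdeleClassGroup L →ₜ* Circle)
              (hμ : Literature.NumberTheory.Automorphic.IdeleClassGroup.IsConjugateSymplectic L μ),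
              Literature.NumberTheory.Automorphic.IdeleClassGroup.HasWeight L μ 1 ∧
              ∃ (a : (↥(maximalRealSubfield L))ˣ) (χ : Chi (↥(maximalRealSubfield L)) L (IsCMField.complexConj L)),
                ∃ f : σ.IntertwiningMap
                    (rhoAtLine (↥(maximalRealSubfield L)) L (IsCMField.complexConj L) 3 e₁ (Matrix.diagonal dV)
                      (complexConj_imagUnit L) (imagUnit_ne_zero L) (imagUnit_mul_self L) (realDiagonal_isSymm L dV hdV)
                      (isUnit_det_realDiagonal L dV hdV hdV0) (realDiagonal_map L dV hdV).symm
                      (fun a => isCompatible_chiSplittingLine L e₁ dV hdV hdV0 (toHeckeCharacter L μ)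
                        (isUnitary_toHeckeCharacter L μ) ((isOscillatorChar_toHeckeCharacter_iff μ).mpr hμ)
                        (TW (↥(maximalRealSubfield L)) a) (isSymm_TW (↥(maximalRealSubfield L)) a)
                        (isUnit_det_TW (↥(maximalRealSubfield L)) a) (JW (↥(maximalRealSubfield L)) L a)
                        (JW_eq (↥(maximalRealSubfield L)) L a))
                      ιV a χ),
                  Function.Injective f)
    (hD : holCotFormSpectralProjection) : StubU2CohFormsSpectrumIsThetaAt :=
  stubU2_of_letters_adm hD (Literature.NumberTheory.Automorphic.UnitaryGroup.CotangentForms.antiholCotFormSpectralProjection_of_hol hD)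
    (ThetaPinBridge.spectrumIsTheta_of_cohFinComponentAdm_of_master hC)

end Summit.HodgeConjecture.HodgeConjecture.Cruxes.H413.P2StubU2OfLettersCadmD

end
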